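import Summits.AtomisticToContinuum.HydrodynamicLimit.Theorems.ImplosionDichotomyHydroLimitProfilewiseBandGuardedInputsDefs
import Summits.AtomisticToContinuum.HydrodynamicLimit.Theorems.OneFlightGossipEngineClampedCurrentsDockTransferTails
import Summits.AtomisticToContinuum.HydrodynamicLimit.Theorems.OneFlightGossipEngineClampedTransferDockSeet
import HarnessLib

/-!
# Guarded tails: ECT_η from SEET_η, TAT_η from CAT_η ∧ EAT_η (stubs `stub_energyCurrentTailsG`, `stub_transferActivityTailsG`
# of line `IdeatorOneSketch` v19, crux `HydroLimitProfilewiseBand`, stmt-AtomisticToContinuum-17372)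

Support file (`--supports stmt-AtomisticToContinuum-17372`).  Skeleton v19 of the line reshapes the true-law tail inputs of the
in-band entropy clock to their GUARD-RELATIVISED forms (statements file
`Theorems/ImplosionDichotomyHydroLimitProfilewiseBandGuardedInputsDefs.lean`, namespace `HydroLimitGuardedInputs`).  This file
re-runs the two cheapest consumers with the packing guard threaded through:
* `stub_energyCurrentTailsG : SEET_η → ECT_η` — the landed `ClampedTransferDockSeet.seet_imp_energyCurrentTails` (rate one,
  level `K ≥ K₀` with `e^{-K} ≤ ε/2`) verbatim, the guard handed from consumer to input;
* `stub_transferActivityTailsG : CAT_η → EAT_η → TAT_η` — the landed `ClampedCurrentsDockTransferTails.stub_transferActivityTails`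
  (pointwise splitting `(p+q)𝟙{V<p+q} ≤ 2p𝟙{V/2<p} + 2q𝟙{V/2<q}`, its generic lemmas `lintegral_tail_le_of_add`,
  `collisionSum_transfer_eq_add` reused by name) with `η₀ := min η₁ η₂` and the two guards read off the consumer's.
QUANTIFIER PLUMBING ONLY; adapted verbatim from the two templates (attributed inline).
prover-line-stmt-AtomisticToContinuum-17372-c13-0 (lead, line cycle 14).
-/

noncomputable section

namespace Summit.AtomisticToContinuum.HydrodynamicLimit.Theorems.HydroLimitGuardedSeetTails

open scoped BigOperators ENNReal Classical Interval
open MeasureTheory Filter Set Topology InformationTheory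
open Literature.MathematicalPhysics.KineticTheory Literature.Analysis.FluidPDE Literature.Analysis.FunctionSpaces
open Summit.AtomisticToContinuum.HydrodynamicLimit.Theses
open Summit.AtomisticToContinuum.HydrodynamicLimit.Theorems
open scoped InnerProductSpace
open Summit.AtomisticToContinuum.HydrodynamicLimit.Theorems.EnergyCurrentTailsLevelCensus
  (ofConfig_postVel_eq_of_mem_contactSet)
open Summit.AtomisticToContinuum.HydrodynamicLimit.Theorems.HydroLimitGuardedInputs
open Summit.AtomisticToContinuum.HydrodynamicLimit.Theorems.ClampedCurrentsDockTransferTails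
  (lintegral_tail_le_of_add collisionSum_transfer_eq_add)
open Summit.AtomisticToContinuum.HydrodynamicLimit.Theorems.ClampedTransferDockSeet (exists_level_exp_le)

/-! ## §1 ECT_η from SEET_η -/

/-- **STUB `stub_energyCurrentTailsG` of line `IdeatorOneSketch` v19 (crux stmt-17372): SEET_η implies ECT_η** — at rate one,
given `ε`, take the level `K ≥ K₀` with `e^{-K} ≤ ε/2` and SEET_η at accuracy `ε/2`; the packing guard is passed through
unchanged (same `η₀`). Adapted verbatim from `ClampedTransferDockSeet.seet_imp_energyCurrentTails`. [folklore] -/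
theorem stub_energyCurrentTailsG : SuperExponentialEnergyTailsGuarded → EnergyCurrentTailsGuarded := by
  -- adapted from Theorems/OneFlightGossipEngineClampedTransferDockSeet.lean (`seet_imp_energyCurrentTails`)
  rintro ⟨η₀, hη₀, h⟩
  refine ⟨η₀, hη₀, fun a₀ θ₀ u₀ ha hθ hu ha0 hθ0 => ?_⟩
  obtain ⟨σ₀, hσ₀, H⟩ := h a₀ θ₀ u₀ ha hθ hu ha0 hθ0
  refine ⟨σ₀, hσ₀, fun σ hσ hσlt T ρ θ u hE hguard Φ htie t ht ε hε => ?_⟩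
  obtain ⟨K₀, -, HK⟩ := H σ hσ hσlt T ρ θ u hE hguard Φ htie t ht 1 one_pos
  obtain ⟨K, hK₀K, hexpK⟩ := exists_level_exp_le K₀ ε hε
  obtain ⟨N₀, HN⟩ := HK K hK₀K (ε / 2) (by positivity)
  refine ⟨K, N₀, fun N hN s hs => (HN N hN s hs).trans (ENNReal.ofReal_le_ofReal ?_)⟩
  have h1 : Real.exp (-(1 * K)) = Real.exp (-K) := by rw [one_mul]
  rw [h1]
  linarith

/-! ## §2 TAT_η from CAT_η ∧ EAT_η -/

/-- **STUB `stub_transferActivityTailsG` of line `IdeatorOneSketch` v19 (crux stmt-17372): CAT_η and EAT_η imply TAT_η** — the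
combined window transfer activity `p + q` (momentum impulse + energy transfer) has L¹ tails under the true law along every GUARDED
tied classical solution: `η₀ := min η₁ η₂`, thresholds `V₀ := 2 max V₁ V₂`, accuracies `ε/4`, and the pointwise splitting
`(p+q)𝟙{V<p+q} ≤ 2p𝟙{V/2<p} + 2q𝟙{V/2<q}` integrated (a.e.-measurability of the momentum activity by the label-aware engine).
Adapted verbatim from `ClampedCurrentsDockTransferTails.stub_transferActivityTails`. [folklore] -/
theorem stub_transferActivityTailsG :
    CollisionActivityTailsGuarded → EnergyActivityTailsGuarded → TransferActivityTailsGuarded := by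
  -- adapted from Theorems/OneFlightGossipEngineClampedCurrentsDockTransferTails.lean (`stub_transferActivityTails`)
  rintro ⟨η₁, hη₁, hCAT⟩ ⟨η₂, hη₂, hCEAT⟩
  refine ⟨min η₁ η₂, lt_min hη₁ hη₂, fun a₀ θ₀ u₀ ha hθ hu ha0 hθ0 => ?_⟩
  obtain ⟨σ₁, hσ₁, h1⟩ := hCAT a₀ θ₀ u₀ ha hθ hu ha0 hθ0
  obtain ⟨σ₂, hσ₂, h2⟩ := hCEAT a₀ θ₀ u₀ ha hθ hu ha0 hθ0
  refine ⟨min (min σ₁ σ₂) (1 / 2), lt_min (lt_min hσ₁ hσ₂) one_half_pos, ?_⟩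
  intro σ hσ hσlt T ρ θ u hE hguard Φ hlim t ht
  have hg1 : ∀ t' ∈ Set.Ico 0 T, ∀ x, ρ t' x * σ ^ 3 < η₁ := fun t' ht' x => (hguard t' ht' x).trans_le (min_le_left _ _)
  have hg2 : ∀ t' ∈ Set.Ico 0 T, ∀ x, ρ t' x * σ ^ 3 < η₂ := fun t' ht' x => (hguard t' ht' x).trans_le (min_le_right _ _)
  have hσ12 : σ < min σ₁ σ₂ := hσlt.trans_le (min_le_left _ _)
  have hσh : σ < 1 / 2 := hσlt.trans_le (min_le_right _ _)
  obtain ⟨V₁, hV₁, hm⟩ := h1 σ hσ (hσ12.trans_le (min_le_left _ _)) T ρ θ u hE hg1 Φ hlim t ht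
  obtain ⟨V₂, hV₂, he⟩ := h2 σ hσ (hσ12.trans_le (min_le_right _ _)) T ρ θ u hE hg2 Φ hlim t ht
  refine ⟨2 * max V₁ V₂, by positivity, ?_⟩
  intro V hV ε hε
  have hV1 : V₁ ≤ V / 2 := by
    have := le_max_left V₁ V₂
    linarith
  have hV2 : V₂ ≤ V / 2 := by
    have := le_max_right V₁ V₂
    linarith
  obtain ⟨τ₁, hτ₁, hm'⟩ := hm (V / 2) hV1 (ε / 4) (by positivity)
  obtain ⟨τ₂, hτ₂, he'⟩ := he (V / 2) hV2 (ε / 4) (by positivity)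
  refine ⟨max τ₁ τ₂, lt_max_of_lt_left hτ₁, ?_⟩
  intro τ hτ
  have hτ0 : 0 < τ := hτ₁.trans_le ((le_max_left _ _).trans hτ)
  obtain ⟨N₁, hm''⟩ := hm' τ ((le_max_left _ _).trans hτ)
  obtain ⟨N₂, he''⟩ := he' τ ((le_max_right _ _).trans hτ)
  refine ⟨max N₁ N₂, ?_⟩
  intro N hN s hs
  have hM := hm'' N ((le_max_left _ _).trans hN) s hs
  have hEn := he'' N ((le_max_right _ _).trans hN) s hs
  dsimp only at hM hEn ⊢
  have hκ : 0 ≤ σ / τ := div_nonneg hσ.le hτ0.le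
  -- the local Gibbs law gives full mass to the good set (it is Liouville-absolutely continuous)
  have hgood : ∀ᵐ z ∂(localGibbsLaw σ a₀ u₀ θ₀ N (Φ N)), z ∈ (Φ N).good := by
    rw [localGibbsLaw_eq]
    exact (localGibbsMeasure_absolutelyContinuous σ a₀ u₀ θ₀ N (Φ N)).ae_le (Φ N).ae_mem_good
  -- a scaled collision sum of a nonnegative functional is nonnegative (every datum)
  have hnn : ∀ (F : HardSphereCollisionRecord (Fin 3) T3 (N + 1) → ℝ), (∀ c, 0 ≤ F c) →
      ∀ (S : Set ℝ) (z : Config (N + 1) (Fin 3) T3), 0 ≤ σ / τ * (Φ N).collisionSum S F z := by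
    intro F hF S z
    refine mul_nonneg hκ ?_
    simp only [HardSphereFlow.collisionSum_eq, collisionSum_eq_collisionPairSum]
    exact collisionPairSum_nonneg fun _ _ _ => hF _
  -- the momentum activity is a.e.-measurable in the datum: on the collisions of an orbit
  -- `‖v_fst⁺ − v_fst⁻‖ = ‖⟪v_fst⁻ − v_snd⁻, ω⟫ ω‖` is a continuous function of the mark (elastic law), so the
  -- label-aware engine `HardSphereFlow.aemeasurable_of_eqOn_collisionSum_labels_torus` applies
  -- (adapted from 9133's `HydroLimitInBandContinuity.aemeasurable_momActivity`)
  have hmeas : ∀ (i : Fin (N + 1)) (a b : ℝ), AEMeasurable (fun z => (Φ N).collisionSum (Ioc a b)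
      (fun c => if c.fst = i then ‖c.postVel.1 - c.preVel.1‖ else 0) z) (localGibbsLaw σ a₀ u₀ θ₀ N (Φ N)) := by
    intro i a b
    have hε : hsDiameter σ N < 2⁻¹ := (hsDiameter_le hσ.le N).trans_lt (by rw [inv_eq_one_div]; exact hσh)
    have hε0 : 0 < hsDiameter σ N := hsDiameter_pos hσ N
    have hFc : ∀ k l : Fin (N + 1), Continuous fun m : ℝ × T3 × V3 × V3 × V3 =>
        if k = i then ‖⟪m.2.2.2.1 - m.2.2.2.2, m.2.2.1⟫_ℝ • m.2.2.1‖ else 0 := by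
      intro k l
      by_cases hk : k = i
      · simp only [hk, if_true]
        fun_prop
      · simp only [hk, if_false]
        exact continuous_const
    refine (Φ N).aemeasurable_of_eqOn_collisionSum_labels_torus hε hFc a b (fun z _ => ?_) hgood
    rw [HardSphereFlow.collisionSum_eq, HardSphereFlow.collisionSum_eq]
    refine collisionSum_congr fun t _ p hp => ?_
    obtain ⟨-, hc⟩ := mem_contactPairs.1 hp
    by_cases hpi : p.1 = i
    · have hpost := congrArg Prod.fst (ofConfig_postVel_eq_of_mem_contactSet hε0 t hc)
      simp only [HardSphereCollisionRecord.ofConfig_fst, HardSphereCollisionRecord.mark_def]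
      rw [if_pos hpi, if_pos hpi, hpost, sub_sub_cancel_left, norm_neg]
    · simp only [HardSphereCollisionRecord.ofConfig_fst]
      rw [if_neg hpi, if_neg hpi]
  refine lintegral_tail_le_of_add (localGibbsLaw σ a₀ u₀ θ₀ N (Φ N)) hε.le
    (a := fun i z => σ / τ * (Φ N).collisionSum (Set.Ioc s (s + τ * ((N : ℝ) + 1) ^ (-(1 / 3 : ℝ))))
      (fun c => if c.fst = i then ‖c.postVel.1 - c.preVel.1‖ + |‖c.postVel.1‖ ^ 2 - ‖c.preVel.1‖ ^ 2| / 2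
        else 0) z)
    (p := fun i z => σ / τ * (Φ N).collisionSum (Set.Ioc s (s + τ * ((N : ℝ) + 1) ^ (-(1 / 3 : ℝ))))
      (fun c => if c.fst = i then ‖c.postVel.1 - c.preVel.1‖ else 0) z)
    (q := fun i z => σ / τ * (Φ N).collisionSum (Set.Ioc s (s + τ * ((N : ℝ) + 1) ^ (-(1 / 3 : ℝ))))
      (fun c => if c.fst = i then |‖c.postVel.1‖ ^ 2 - ‖c.preVel.1‖ ^ 2| / 2 else 0) z)
    (fun i z => hnn _ (fun c => by positivity) _ z) (fun i z => hnn _ (fun c => by positivity) _ z)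
    ?_ (fun i => (hmeas i _ _).const_mul _) hM hEn
  filter_upwards [hgood] with z hz
  intro i
  rw [collisionSum_transfer_eq_add (Φ N) hz, mul_add]

end Summit.AtomisticToContinuum.HydrodynamicLimit.Theorems.HydroLimitGuardedSeetTails

end
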